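import Summits.ValiantsHypothesis.ValiantsHypothesis.Theorems.DepthWindowHomComponents
import Mathlib.Algebra.Order.BigOperators.Group.LocallyFinite
import Mathlib.Algebra.BigOperators.Intervals
import HarnessLib

/-!
# Route `DepthWindow`, g8 — the first-jump expansion of a truncated product (sparse ABP, step 1)

Kernel piece (i) of the SPARSE form of the `(2,3)` sliver lemma (lens-4 NODE-v8 §8): for factors
`U_m, U_{m+1}, …, U_{m+n-1}` and a weight `η`, writing `c_l := [U_l]_0` for the weight-`0`
components,

`[∏_{m ≤ l < m+n} U_l]_η = [η = 0]·∏_l c_l + ∑_{m ≤ j < m+n} (∏_{m ≤ l < j} c_l) · ∑_{1 ≤ ρ ≤ η} [U_j]_ρ · [∏_{j < l < m+n} U_l]_{η-ρ}`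

(`weightedHomogeneousComponent_prod_Ico_firstJump`): condition on the FIRST factor `j` that
contributes positive weight `ρ`.  Unrolled, this is the layered branching program whose time axis
is the number of positive-weight factors (at most `η ≤ d` of them) and whose states are
(weight so far, position) — the sparse ABP of size `(d+1)(t+1)` per layer that meet-in-the-middle
(`Theorems/DepthWindowIMMPaths.lean`) turns into a `Σ Π^{[√d]} Σ Π^{[√d]}` formula of size
`(d·t)^{O(√d)}` for fan-in `t` — the sliver regime `t ≤ 2^{O(d^{1.5})}`.  No normalisation
`U_l = c_l (1 + ũ_l)` and no division is used: the skipped factors contribute their weight-`0`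
components as they are (scalars `C (coeff 0 U_l)` when all weights are positive).
Pure algebra over a commutative semiring; nothing here bears on `VP ≠ VNP`.

[cite: LimayeSrinivasanTavenas2025, Lemma 11] [cite: Strassen1973, §3]
-/

set_option linter.dupNamespace false

namespace Summit.ValiantsHypothesis.ValiantsHypothesis.Theorems.DepthWindow

open MvPolynomial Finset

variable {σ R : Type*} [CommSemiring R]

/-- `[1]_η = [η = 0]`. -/
theorem weightedHomogeneousComponent_one_eq_ite (w : σ → ℕ) (η : ℕ) :
    weightedHomogeneousComponent w η (1 : MvPolynomial σ R) = if η = 0 then 1 else 0 := by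
  classical
  exact weightedHomogeneousComponent_of_mem
    ((mem_weightedHomogeneousSubmodule R w 0 1).mpr (isWeightedHomogeneous_one R w))

/-- Splitting off the weight-`0` part of the first factor in `[p·q]_η`:
`[p q]_η = [p]_0 [q]_η + ∑_{1 ≤ ρ ≤ η} [p]_ρ [q]_{η-ρ}` (`ρ = i + 1`). -/
theorem weightedHomogeneousComponent_mul_split (w : σ → ℕ) (η : ℕ) (p q : MvPolynomial σ R) :
    weightedHomogeneousComponent w η (p * q) =
      weightedHomogeneousComponent w 0 p * weightedHomogeneousComponent w η q +
        ∑ i ∈ range η, weightedHomogeneousComponent w (i + 1) p *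
          weightedHomogeneousComponent w (η - (i + 1)) q := by
  rw [weightedHomogeneousComponent_mul, Finset.Nat.sum_antidiagonal_eq_sum_range_succ_mk,
    Finset.sum_range_succ', Nat.sub_zero, add_comm]

/-- **First-jump expansion** of the weight-`η` component of a product of consecutive factors
`U_m ⋯ U_{m+n-1}`: either no factor contributes positive weight (`η = 0`, all weight-`0` parts),
or `j` is the first factor contributing a positive weight `ρ = i+1`, the factors before it
contribute their weight-`0` parts and the factors after it the weight `η - ρ`.
[cite: LimayeSrinivasanTavenas2025, Lemma 11] -/
theorem weightedHomogeneousComponent_prod_Ico_firstJump (w : σ → ℕ) (U : ℕ → MvPolynomial σ R) :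
    ∀ n m η : ℕ,
      weightedHomogeneousComponent w η (∏ l ∈ Ico m (m + n), U l) =
        (if η = 0 then ∏ l ∈ Ico m (m + n), weightedHomogeneousComponent w 0 (U l) else 0) +
          ∑ j ∈ Ico m (m + n), (∏ l ∈ Ico m j, weightedHomogeneousComponent w 0 (U l)) *
            ∑ i ∈ range η, weightedHomogeneousComponent w (i + 1) (U j) *
              weightedHomogeneousComponent w (η - (i + 1)) (∏ l ∈ Ico (j + 1) (m + n), U l)
  | 0, m, η => by
      simp only [Finset.Ico_self, Finset.prod_empty, Finset.sum_empty, add_zero]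
      exact weightedHomogeneousComponent_one_eq_ite w η
  | n + 1, m, η => by
      have hlt : m < m + (n + 1) := by omega
      rw [Finset.prod_eq_prod_Ico_succ_bot hlt, weightedHomogeneousComponent_mul_split,
        Finset.sum_eq_sum_Ico_succ_bot hlt,
        Finset.prod_eq_prod_Ico_succ_bot hlt (fun l => weightedHomogeneousComponent w 0 (U l)),
        Finset.Ico_self, Finset.prod_empty, one_mul]
      have e1 : m + (n + 1) = (m + 1) + n := by ring
      rw [e1, weightedHomogeneousComponent_prod_Ico_firstJump w U n (m + 1) η, mul_add, Finset.mul_sum]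
      have hj : ∀ j ∈ Ico (m + 1) (m + 1 + n),
          (∏ l ∈ Ico m j, weightedHomogeneousComponent w 0 (U l)) *
              ∑ i ∈ range η, weightedHomogeneousComponent w (i + 1) (U j) *
                weightedHomogeneousComponent w (η - (i + 1)) (∏ l ∈ Ico (j + 1) (m + 1 + n), U l) =
            weightedHomogeneousComponent w 0 (U m) *
              ((∏ l ∈ Ico (m + 1) j, weightedHomogeneousComponent w 0 (U l)) *
                ∑ i ∈ range η, weightedHomogeneousComponent w (i + 1) (U j) *
                  weightedHomogeneousComponent w (η - (i + 1))
                    (∏ l ∈ Ico (j + 1) (m + 1 + n), U l)) := by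
        intro j hj
        rw [Finset.mem_Ico] at hj
        rw [Finset.prod_eq_prod_Ico_succ_bot (show m < j by omega), mul_assoc]
      rw [Finset.sum_congr rfl hj]
      by_cases hη : η = 0
      · simp only [hη, if_true]; ring
      · simp only [hη, if_false, mul_zero, zero_add]; ring

/-- The same expansion for a product over `Fin t` (the shape used by the gate lists):
`[∏_{l<t} V_l]_η` with `U l := V l` for `l < t`. -/
theorem weightedHomogeneousComponent_prod_firstJump (w : σ → ℕ) {t : ℕ}
    (V : Fin t → MvPolynomial σ R) (η : ℕ) :
    weightedHomogeneousComponent w η (∏ l, V l) =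
      (if η = 0 then ∏ l : Fin t, weightedHomogeneousComponent w 0 (V l) else 0) +
        ∑ j : Fin t, (∏ l ∈ Ico 0 (j : ℕ),
            weightedHomogeneousComponent w 0 (if h : l < t then V ⟨l, h⟩ else 1)) *
          ∑ i ∈ range η, weightedHomogeneousComponent w (i + 1) (V j) *
            weightedHomogeneousComponent w (η - (i + 1))
              (∏ l ∈ Ico ((j : ℕ) + 1) t, if h : l < t then V ⟨l, h⟩ else 1) := by
  have h := weightedHomogeneousComponent_prod_Ico_firstJump w
    (fun l => if h : l < t then V ⟨l, h⟩ else 1) t 0 η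
  rw [Nat.zero_add] at h
  have hprod : ∀ (f : MvPolynomial σ R → MvPolynomial σ R),
      ∏ l ∈ Ico 0 t, f (if h : l < t then V ⟨l, h⟩ else 1) = ∏ l : Fin t, f (V l) := by
    intro f
    rw [← Finset.range_eq_Ico, ← Fin.prod_univ_eq_prod_range (fun l => f (if h : l < t then V ⟨l, h⟩ else 1))]
    exact Fintype.prod_congr _ _ fun l => by rw [dif_pos l.isLt]
  have hsum : ∀ (g : ℕ → MvPolynomial σ R → MvPolynomial σ R),
      ∑ j ∈ Ico 0 t, g j (if h : j < t then V ⟨j, h⟩ else 1) = ∑ j : Fin t, g j (V j) := by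
    intro g
    rw [← Finset.range_eq_Ico, ← Fin.sum_univ_eq_sum_range (fun j => g j (if h : j < t then V ⟨j, h⟩ else 1))]
    exact Fintype.sum_congr _ _ fun j => by rw [dif_pos j.isLt]
  rw [hprod (fun p => p), hprod (fun p => weightedHomogeneousComponent w 0 p),
    hsum (fun j p => (∏ l ∈ Ico 0 j, weightedHomogeneousComponent w 0
      (if h : l < t then V ⟨l, h⟩ else 1)) * ∑ i ∈ range η, weightedHomogeneousComponent w (i + 1) p *
        weightedHomogeneousComponent w (η - (i + 1))
          (∏ l ∈ Ico (j + 1) t, if h : l < t then V ⟨l, h⟩ else 1))] at h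
  exact h

end Summit.ValiantsHypothesis.ValiantsHypothesis.Theorems.DepthWindow
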